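/-
Copyright (c) 2026 the pub-hodgecm-mathlib formalisation cell (harness21).  Prover seat hodgecm-mathlib-K2E2-p12 (g5): Track B «K2-LIT», ENGINE E1,
h413 = stmt-HodgeConjecture-24833; W5₃ (L3): deal (57)(ii) of K2E1-plan (g6) «(L3-bad) BAD-PLACE LOCAL FACTOR TO σ > 1», part (B): split bad places, and (C) the all-places package.
-/
import Summits.HodgeConjecture.HodgeConjecture.Theorems.K2E1IntertwiningLocalFactorBadPlaceU3       -- ★ (this seat) part (A): `integrable_localHeight_rpow_neg_of_nonsplit`
import Summits.HodgeConjecture.HodgeConjecture.Theorems.K2E1BigCellCoordinateChangeGL3             -- ★ (this seat): `measurePreserving_shear_fin_three`, `bigCellMatrix_mulVec`, `det_bigCellMatrix`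
import Summits.HodgeConjecture.HodgeConjecture.Theorems.K2E1IntertwiningLocalMeanSplitU3           -- ★ (3-ii) (K2-defs1): `integrable_gkCell_pi`
import HarnessLib

/-!
# K2·E1 — `K2E1IntertwiningLocalFactorBadPlaceSplitU3` (deal (57)(ii) «(L3-bad)», parts (B)+(C)): `Q_v^{−σ}` IS INTEGRABLE FOR EVERY REAL `σ > 1` AT EVERY SPLIT PLACE
# (`|δ_w| ≠ 1`, `|2| ≠ 1` allowed), AND HENCE AT EVERY PLACE OF `L⁺` — F3's letter `hT` ∕ (β)'s every-place integrability at the sharp abscissa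

Track B ∕ K2-LIT, crux h413 = `stmt-HodgeConjecture-24833`, route of record `HCCMUnconditional`; cell `hodgecm-mathlib`, squad K2, ENGINE E1 (W5₃ (L3)).  THEOREMS ONLY (no `def`,
no instance, no notation, no `sorry`; default heartbeats); lane `--supports stmt-HodgeConjecture-24833 --as helper` (count-neutral).  At a split `v` (`{w' ∣ v} = {w, w̄}`,
`δ₁ = δ_w ∈ L⁺_v`): `Q_v = (A·B) ∘ Φ` EXACTLY (★ `prod_placesOver_max_one_norm_height_eq_gl3_of_split`, NO unit hypothesis), `Φ(p) = (p₀+δ₁p₁, −(p₀−δ₁p₁), δ₁p₂ − ½(…)(…)) = S ∘ M`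
(shear ∘ linear, `det M = 2δ₁²`), so `(ν³).map Φ = ‖2δ₁²‖⁻¹ • ν³` (★ `map_linearEquiv_addHaar`, ★ `distribHaarChar_eq_normAbs`, ★ shear) and integrability of `(A·B)^{−σ} ∘ Φ` is that of
`(A·B)^{−σ}` = ★ (3-ii) `integrable_gkCell_pi` (abstract local field, `σ > 1`).
* §1 `map_pi_mulVec_eq_smul` (rank-generic Jacobian: `(μ^ι).map (M·) = ‖det M‖⁻¹ • μ^ι`), `measurePreserving_bigCellChange_smul` (`Φ : μ³ → ‖2δ₁²‖⁻¹ • μ³`),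
  `integrable_comp_bigCellChange` (`Integrable G μ³ → Integrable (G ∘ Φ) μ³`, `2, δ₁ ≠ 0`).
* §2 `localHeight_rpow_neg_eq_gkCell_comp` (pointwise), **`integrable_localHeight_rpow_neg_of_split (hw : c•w ≠ w) (hσ : 1 < σ)`**.
* §3 **`integrable_localHeight_rpow_neg (v) (hσ : 1 < σ)`** (HEAD, EVERY place): F3's `hT` integrand VERBATIM — `hT := fun v _ σ hσ => integrable_localHeight_rpow_neg … v (νv v) hσ`.
HONEST LABEL: HC_CM is proved only modulo the 7 printed citations (2 remaining named inputs: hLiu418 = `stmt-HodgeConjecture-24832`, h413 = `stmt-HodgeConjecture-24833`) until rung 0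
closes; this file asserts no named fact and closes no socket; count-neutral; unconditional.

## References
* [Langlands1971] R. P. Langlands, *Euler Products* (1971): §3.
* [TateThesis1967] J. Tate, *Fourier analysis in number fields and Hecke's zeta-functions* (1967): §2.2 (Lemma 2.2.5), §3.3.
* [WeilBNT1967] A. Weil, *Basic Number Theory* (1967): Ch. I §2, Ch. II §5 (module of an automorphism).
-/

set_option autoImplicit false
set_option linter.dupNamespace false -- the mandated namespace repeats `HodgeConjecture.HodgeConjecture`

noncomputable section

open MeasureTheory NumberField IsDedekindDomain Filter Matrix
open scoped NNReal ENNReal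
open Literature.NumberTheory.Automorphic Literature.NumberTheory.Automorphic.UnitaryGroup Literature.NumberTheory.GaloisRepresentations
open Literature.NumberTheory.GaloisRepresentations.IsNonarchimedeanLocalField
open Literature.NumberTheory.GelbartRogawski1991.UnitaryDualPair.LocalSplitting (splitSqrt splitSqrt_ne_zero)
open Summit.HodgeConjecture.HodgeConjecture.Cruxes.H413.K2E1BigCellCoordinateChangeGL3 (measurePreserving_shear_fin_three bigCellMatrix_mulVec det_bigCellMatrix)
open Summit.HodgeConjecture.HodgeConjecture.Cruxes.H413.K2E1IntertwiningLocalFactorU3HeightSplit (prod_placesOver_max_one_norm_height_eq_gl3_of_split)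
open Summit.HodgeConjecture.HodgeConjecture.Cruxes.H413.K2E1IntertwiningLocalHeightU3 (continuous_localHeight_rpow)
open Summit.HodgeConjecture.HodgeConjecture.Cruxes.H413.K2E1IntertwiningLocalMeanSplitU3 (integrable_gkCell_pi)
open Summit.HodgeConjecture.HodgeConjecture.Cruxes.H413.K2E1IntertwiningLocalFactorBadPlaceU3 (integrable_localHeight_rpow_neg_of_nonsplit)

namespace Summit.HodgeConjecture.HodgeConjecture.Cruxes.H413.K2E1IntertwiningLocalFactorBadPlaceSplitU3

/-! ## §1 The Jacobian of a linear change and of the big-cell change (abstract local field) -/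

section LocalField

variable {F : Type*} [Field F] [ValuativeRel F] [TopologicalSpace F] [IsNonarchimedeanLocalField F]
  [MeasurableSpace F] [BorelSpace F] (μ : Measure F) [μ.IsAddHaarMeasure]

/-- **`(μ^ι).map (p ↦ M p) = ‖det M‖_F⁻¹ • μ^ι`** for an invertible matrix `M` (★ `map_linearEquiv_addHaar`, ★ `distribHaarChar_eq_normAbs`). [cite: TateThesis1967, §2.2] [cite: WeilBNT1967, Ch. I §2] -/
theorem map_pi_mulVec_eq_smul {ι : Type} [Fintype ι] [DecidableEq ι] (M : Matrix ι ι F) (hdet : M.det ≠ 0) :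
    (Measure.pi fun _ : ι => μ).map (fun p : ι → F => M *ᵥ p) = (normAbs F M.det)⁻¹ • Measure.pi fun _ : ι => μ := by
  haveI := secondCountableTopology_localField F
  haveI := sigmaCompactSpace_of_isNonarchimedeanLocalField F
  set Le : (ι → F) ≃ₗ[F] (ι → F) := Matrix.toLinearEquiv' M (Matrix.invertibleOfIsUnitDet M (Ne.isUnit hdet)) with hLe
  have hLM : (fun p : ι → F => M *ᵥ p) = (Le : (ι → F) → (ι → F)) := by
    funext p
    rfl
  have hdetL : LinearEquiv.det Le = Units.mk0 M.det hdet := by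
    ext
    rw [LinearEquiv.coe_det, Units.val_mk0, hLe, Matrix.toLinearEquiv'_apply, LinearMap.det_toLin']
  rw [hLM, Literature.MeasureTheory.Group.map_linearEquiv_addHaar (Measure.pi fun _ : ι => μ) Le, hdetL, UnitaryGroup.distribHaarChar_eq_normAbs, Units.val_mk0]

/-- **THE BIG-CELL CHANGE MULTIPLIES `μ³` BY `‖2δ₁²‖⁻¹`**: `Φ = S ∘ M` with the shear `S` (★ measure-preserving) and `det M = 2δ₁²`, so `Φ` is measure-preserving from `μ³` to `‖2δ₁²‖⁻¹ • μ³`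
(`2, δ₁ ≠ 0`). [cite: TateThesis1967, §2.2] [cite: Langlands1971, §3] -/
theorem measurePreserving_bigCellChange_smul {δ₁ : F} (hδ : δ₁ ≠ 0) (h2 : (2 : F) ≠ 0) :
    MeasurePreserving (fun p : Fin 3 → F => ![p 0 + δ₁ * p 1, -(p 0 - δ₁ * p 1), δ₁ * p 2 - 2⁻¹ * (p 0 + δ₁ * p 1) * (p 0 - δ₁ * p 1)])
      (Measure.pi fun _ : Fin 3 => μ) ((normAbs F (2 * δ₁ ^ 2))⁻¹ • Measure.pi fun _ : Fin 3 => μ) := by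
  haveI := secondCountableTopology_localField F
  haveI := sigmaCompactSpace_of_isNonarchimedeanLocalField F
  have hdet : (!![(1 : F), δ₁, 0; -1, δ₁, 0; 0, 0, δ₁]).det ≠ 0 := by
    rw [det_bigCellMatrix]; exact mul_ne_zero h2 (pow_ne_zero 2 hδ)
  have hmeasM : Measurable fun p : Fin 3 → F => !![(1 : F), δ₁, 0; -1, δ₁, 0; 0, 0, δ₁] *ᵥ p :=
    Continuous.measurable (continuous_pi fun i => by
      simp only [Matrix.mulVec, dotProduct]
      exact continuous_finsetSum _ fun j _ => continuous_const.mul (continuous_apply j))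
  have hL : MeasurePreserving (fun p : Fin 3 → F => !![(1 : F), δ₁, 0; -1, δ₁, 0; 0, 0, δ₁] *ᵥ p)
      (Measure.pi fun _ : Fin 3 => μ) ((normAbs F (2 * δ₁ ^ 2))⁻¹ • Measure.pi fun _ : Fin 3 => μ) :=
    ⟨hmeasM, by rw [map_pi_mulVec_eq_smul μ _ hdet, det_bigCellMatrix]⟩
  have hφ : Measurable (Function.uncurry fun x y : F => 2⁻¹ * x * y) := (measurable_const.mul measurable_fst).mul measurable_snd
  have hS := measurePreserving_shear_fin_three μ hφ
  have hS' : MeasurePreserving (fun p : Fin 3 → F => Function.update p 2 (p 2 + 2⁻¹ * p 0 * p 1))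
      ((normAbs F (2 * δ₁ ^ 2))⁻¹ • Measure.pi fun _ : Fin 3 => μ) ((normAbs F (2 * δ₁ ^ 2))⁻¹ • Measure.pi fun _ : Fin 3 => μ) :=
    ⟨hS.measurable, by rw [Measure.map_smul, hS.map_eq]⟩
  have hcomp : (fun p : Fin 3 → F => ![p 0 + δ₁ * p 1, -(p 0 - δ₁ * p 1), δ₁ * p 2 - 2⁻¹ * (p 0 + δ₁ * p 1) * (p 0 - δ₁ * p 1)]) =
      (fun p : Fin 3 → F => Function.update p 2 (p 2 + 2⁻¹ * p 0 * p 1)) ∘ (fun p : Fin 3 → F => !![(1 : F), δ₁, 0; -1, δ₁, 0; 0, 0, δ₁] *ᵥ p) := by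
    funext p
    rw [Function.comp_apply, bigCellMatrix_mulVec]
    ext i
    fin_cases i
    · simp
    · simp
    · simp
      ring
  rw [hcomp]
  exact hS'.comp hL

/-- **TRANSPORT OF INTEGRABILITY ALONG THE BIG-CELL CHANGE** (`2, δ₁ ≠ 0`): `Integrable G μ³ → Integrable (G ∘ Φ) μ³`. [cite: TateThesis1967, §2.2] -/
theorem integrable_comp_bigCellChange {E : Type*} [NormedAddCommGroup E] {δ₁ : F} (hδ : δ₁ ≠ 0) (h2 : (2 : F) ≠ 0) {G : (Fin 3 → F) → E}
    (hG : Integrable G (Measure.pi fun _ : Fin 3 => μ)) :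
    Integrable (fun p : Fin 3 → F => G ![p 0 + δ₁ * p 1, -(p 0 - δ₁ * p 1), δ₁ * p 2 - 2⁻¹ * (p 0 + δ₁ * p 1) * (p 0 - δ₁ * p 1)])
      (Measure.pi fun _ : Fin 3 => μ) := by
  have hΦ := measurePreserving_bigCellChange_smul μ hδ h2
  have hG' : Integrable G ((normAbs F (2 * δ₁ ^ 2))⁻¹ • Measure.pi fun _ : Fin 3 => μ) := by
    exact hG.smul_measure_nnreal
  exact (hΦ.integrable_comp hG'.aestronglyMeasurable).2 hG'

end LocalField

/-! ## §2 Split bad places -/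

section CM

variable (L : Type) [Field L] [NumberField L] [IsCMField L] {δ : L} (hcδ : IsCMField.complexConj L δ = -δ) (hδ : δ ≠ 0)
  {d : ↥(maximalRealSubfield L)} (hd : δ * δ = algebraMap ↥(maximalRealSubfield L) L d) (v : HeightOneSpectrum (𝓞 ↥(maximalRealSubfield L))) (w : PlacesOver L v)
  [MeasurableSpace (v.adicCompletion ↥(maximalRealSubfield L))] [BorelSpace (v.adicCompletion ↥(maximalRealSubfield L))] (νv : Measure (v.adicCompletion ↥(maximalRealSubfield L))) [νv.IsAddHaarMeasure]

include hd in
/-- **`Q_v^{−σ}` IS INTEGRABLE FOR EVERY REAL `σ > 1` AT EVERY SPLIT PLACE** (`|δ_w| ≠ 1`, `|2| ≠ 1` allowed): `Q_v^{−σ} = (A^{−σ}·B^{−σ}) ∘ Φ` ★ and §1 transports ★ (3-ii)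
`integrable_gkCell_pi`. [cite: Langlands1971, §3] [cite: TateThesis1967, §3.3] -/
theorem integrable_localHeight_rpow_neg_of_split (hw : IsCMField.complexConj L • w.1 ≠ w.1) {σ : ℝ} (hσ : 1 < σ) :
    Integrable (fun p : Fin 3 → v.adicCompletion ↥(maximalRealSubfield L) =>
      (∏ w' : PlacesOver L v, max 1 (max ((normAbs (w'.1.adicCompletion L) (quadraticLocalEquiv L v (IsCMField.complexConj L) hcδ hδ (p 0, p 1) w') : ℝ≥0) : ℝ)
          ((normAbs (w'.1.adicCompletion L) ((toLocalRing L v (p 2) * algebraMap L (LocalRing L v) δ -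
            toLocalRing L v 2⁻¹ * (quadraticLocalEquiv L v (IsCMField.complexConj L) hcδ hδ (p 0, p 1) *
              conjLocal L (IsCMField.complexConj L) v (quadraticLocalEquiv L v (IsCMField.complexConj L) hcδ hδ (p 0, p 1)))) w') : ℝ≥0) : ℝ))) ^ (-σ)) (Measure.pi fun _ : Fin 3 => νv) := by
  haveI : Algebra.IsQuadraticExtension ↥(maximalRealSubfield L) L := IsCMField.isQuadraticExtension L
  have hδ₁ : splitSqrt ↥(maximalRealSubfield L) L (IsCMField.complexConj L) hcδ hδ v w ≠ 0 := splitSqrt_ne_zero ↥(maximalRealSubfield L) L (IsCMField.complexConj L) hcδ hδ hd v w hw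
  have hG := integrable_comp_bigCellChange νv hδ₁ (two_ne_zero : (2 : v.adicCompletion ↥(maximalRealSubfield L)) ≠ 0) (G := (fun q : Fin 3 → v.adicCompletion ↥(maximalRealSubfield L) => (max 1 (max ((normAbs (v.adicCompletion ↥(maximalRealSubfield L)) (q 0) : ℝ≥0) : ℝ) ((normAbs (v.adicCompletion ↥(maximalRealSubfield L)) (q 2) : ℝ≥0) : ℝ))) ^ (-σ) *
      (max 1 (max ((normAbs (v.adicCompletion ↥(maximalRealSubfield L)) (q 1) : ℝ≥0) : ℝ) ((normAbs (v.adicCompletion ↥(maximalRealSubfield L)) (q 2 - q 0 * q 1) : ℝ≥0) : ℝ))) ^ (-σ))) (integrable_gkCell_pi νv hσ)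
  refine hG.congr (Eventually.of_forall fun p => ?_)
  simp only [Matrix.cons_val_zero, Matrix.cons_val_one, Matrix.cons_val_two, Matrix.head_cons, Matrix.tail_cons]
  rw [prod_placesOver_max_one_norm_height_eq_gl3_of_split L (IsCMField.complexConj L) hcδ hδ hd v w hw (p 0) (p 1) (p 2),
    Real.mul_rpow (le_trans zero_le_one (le_max_left _ _)) (le_trans zero_le_one (le_max_left _ _))]

/-! ## §3 Every place -/

include hd in
/-- **`Q_v^{−σ}` IS INTEGRABLE FOR EVERY REAL `σ > 1` AT EVERY FINITE PLACE `v` OF `L⁺`** — no goodness, ramification or unit hypothesis: non-split places by part (A) ★, split places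
by §2.  This is F3's letter `hT` (`K2E1WhittakerContinuationConcreteU3`) integrand VERBATIM, and the `σ > 1` edition of (β)'s every-place integrability. [cite: Langlands1971, §3] [cite: TateThesis1967, §3.3] -/
theorem integrable_localHeight_rpow_neg {σ : ℝ} (hσ : 1 < σ) :
    Integrable (fun p : Fin 3 → v.adicCompletion ↥(maximalRealSubfield L) =>
      (∏ w' : PlacesOver L v, max 1 (max ((normAbs (w'.1.adicCompletion L) (quadraticLocalEquiv L v (IsCMField.complexConj L) hcδ hδ (p 0, p 1) w') : ℝ≥0) : ℝ)
          ((normAbs (w'.1.adicCompletion L) ((toLocalRing L v (p 2) * algebraMap L (LocalRing L v) δ -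
            toLocalRing L v 2⁻¹ * (quadraticLocalEquiv L v (IsCMField.complexConj L) hcδ hδ (p 0, p 1) *
              conjLocal L (IsCMField.complexConj L) v (quadraticLocalEquiv L v (IsCMField.complexConj L) hcδ hδ (p 0, p 1)))) w') : ℝ≥0) : ℝ))) ^ (-σ)) (Measure.pi fun _ : Fin 3 => νv) := by
  haveI : Algebra.IsQuadraticExtension ↥(maximalRealSubfield L) L := IsCMField.isQuadraticExtension L
  obtain ⟨w⟩ := PlacesOver.nonempty L v
  by_cases hw : IsCMField.complexConj L • w.1 = w.1
  · exact integrable_localHeight_rpow_neg_of_nonsplit L hcδ hδ hd v w νv hw hσ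
  · exact integrable_localHeight_rpow_neg_of_split L hcδ hδ hd v w νv hw hσ

end CM

end Summit.HodgeConjecture.HodgeConjecture.Cruxes.H413.K2E1IntertwiningLocalFactorBadPlaceSplitU3

end
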